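import Summits.HodgeConjecture.CorCM.MultiFieldWeilTwinUnits
import HarnessLib

/-!
# MULTI-FIELD WEIL ENGINE — SEVERAL TWIN UNITS: the defect law for tuple sets with ANY number of twin pairs of slots (pairs reading ONE frame, diagonal tuples), stabiliser-transitive
# across units (census level)

Cell `pub-hodgecm2` (COR-CM), seat b30 gen 37 (2026-08-25); own lane MULTI-FIELD WEIL ENGINE (stem `MultiFieldWeil*`), census level, sequel of `CorCM/MultiFieldWeilTwinUnits.lean` (T1: ONE twin
pair).  Theorems only; no definition, no named fact, no `sorry`, no `decide`.  HONEST FRAMING: pure finite combinatorics; `HC_CM` is NOT touched.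

**`exists_hasDefectsG_of_twinsStabiliserTransitive`** — the twin pairs are the fibres of an involution `tw : Fin r → Fin r` (`tw m = m`: a single slot; `tw m ≠ m`: the twin pair
`{m, tw m}`, one size `≥ 3`, DIAGONAL tuples, `2`-transitive components, singleton position sets `{q_m} ≠ {q_{tw m}}` under the identification); `R` non-empty, closed, transitive on
every slot, STABILISER-TRANSITIVE ACROSS UNITS; all slots of PRIME size with proper non-empty position sets.  Then every configuration balanced under `R` obeys the defect law.
PROOF.  Transfer to the unit-wise product `R⁺` (T1 §1); the single slots by V1's prime tower with all twin slots excluded; each twin unit `{m, tw m}` by T1's twin lemma on the sub-family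
`D_m ⊆ R⁺` of tuples agreeing with a base tuple OFF the unit — there the other units' signed sums are literally constant, and `D_m` still carries every `R`-component of the unit
(`R⁺` is a product), hence is diagonal and `2`-transitive.  This is the census core for «SEVERAL doubled fields `k·F_j⁺` over one imaginary quadratic field» in the classes-per-field
theorems (`CorCM/MultiFieldWeilTwoPerField*`: at present ONE doubled field per k-group); the realised reading and the family dress follow the one-pair files T2–T7 verbatim.
[cite: MoonenZarhin1995Duke, Thm. 2.4] [cite: Pohlmann1968, Thm 1] [cite: GaoUllmo2025, Thm 3.1] [cite: DixonMortimer1996, §1.6 and Thm. 1.6A; §2.1]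
-/

noncomputable section

namespace Summit.HodgeConjecture.CorCM.MultiFieldWeil

open Finset
open Summit.HodgeConjecture.CorCM.Census.MultiFieldWeil

open scoped Classical

section Model

variable {r : ℕ} {n : Fin r → ℕ} {R : Finset (PermsG n)} {P : ∀ m : Fin r, Finset (Fin (n m))}

/-- **THE DEFECT LAW WITH SEVERAL TWIN PAIRS.**  See the module docstring. [cite: MoonenZarhin1995Duke, Thm. 2.4] [cite: DixonMortimer1996, §1.6 and Thm. 1.6A; §2.1]
[cite: GaoUllmo2025, Thm 3.1] -/
theorem exists_hasDefectsG_of_twinsStabiliserTransitive (hmul : ∀ π ∈ R, ∀ π' ∈ R, π * π' ∈ R) (hinv : ∀ π ∈ R, π⁻¹ ∈ R) (hne : R.Nonempty)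
    (htrans : ∀ (m : Fin r) (a a' : Fin (n m)), ∃ π ∈ R, π m a = a')
    (tw : Fin r → Fin r) (htw : ∀ m, tw (tw m) = m) (hn : ∀ m, n (tw m) = n m) (h3 : ∀ m, tw m ≠ m → 3 ≤ n m)
    (hdiag : ∀ π ∈ R, ∀ m, tw m ≠ m → ∀ a : Fin (n (tw m)), Fin.cast (hn m) (π (tw m) a) = π m (Fin.cast (hn m) a))
    (h2t : ∀ m, tw m ≠ m → ∀ a a' b b' : Fin (n m), a ≠ a' → b ≠ b' → ∃ π ∈ R, π m a = b ∧ π m a' = b')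
    (hstab : ∀ (m₀ m : Fin r), m₀ ≠ m → tw m₀ ≠ m → ∀ a a' : Fin (n m), ∃ ν ∈ R, ν m₀ = 1 ∧ ν (tw m₀) = 1 ∧ ν m a = a')
    (hpr : ∀ m, (n m).Prime) (hP0 : ∀ m, (P m).Nonempty) (hPn : ∀ m, (P m).card < n m)
    (q : ∀ m : Fin r, Fin (n m)) (hPq : ∀ m, tw m ≠ m → P m = {q m}) (hq : ∀ m, tw m ≠ m → Fin.cast (hn m) (q (tw m)) ≠ q m)
    (c : Fin r → ℕ) (hc : ∀ m, ((c m : ℕ) : ℤ) = (n m : ℤ) - 2 * (P m).card)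
    {α : Type} (v : α → PtG n) (T : Finset α) (hT : ModelBalancedG P R v T) : ∃ t : Fin r → ℤ, HasDefectsG c v T t := by
  have h1R : (1 : PermsG n) ∈ R := one_mem_of_closed hmul hinv hne
  -- the units: `U m = U m' ↔ m' ∈ {m, tw m}`
  let U : Fin r → Fin r := fun m => if (tw m : ℕ) < (m : ℕ) then tw m else m
  have hUtw : ∀ m, U (tw m) = U m := by
    intro m
    simp only [U, htw]
    by_cases h : (tw m : ℕ) < (m : ℕ)
    · rw [if_pos h, if_neg (lt_asymm h)]
    · rw [if_neg h]
      by_cases h' : (m : ℕ) < (tw m : ℕ)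
      · rw [if_pos h']
      · have : (tw m : ℕ) = m := by omega
        rw [if_neg (by omega)]; exact Fin.ext this
  have hUmem : ∀ m, U m = m ∨ U m = tw m := fun m => by
    simp only [U]; split_ifs
    · exact Or.inr rfl
    · exact Or.inl rfl
  have hUfib : ∀ m m', U m' = U m ↔ m' = m ∨ m' = tw m := by
    intro m m'
    constructor
    · intro h
      rcases hUmem m' with h₁ | h₁ <;> rcases hUmem m with h₂ | h₂
      · exact Or.inl (h₁.symm.trans (h.trans h₂))
      · exact Or.inr (h₁.symm.trans (h.trans h₂))
      · right; have := h₁.symm.trans (h.trans h₂); rw [← this, htw]  -- tw m' = m → m' = tw m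
      · left; have := h₁.symm.trans (h.trans h₂)  -- tw m' = tw m → m' = m
        rw [← htw m', this, htw]
    · rintro (rfl | rfl)
      · rfl
      · exact hUtw m
  -- the unit-wise product `R'`
  set R' : Finset (PermsG n) := Finset.univ.filter fun π' => ∀ m₀, ∃ π ∈ R, ∀ m, U m = U m₀ → π m = π' m with hR'
  have hmemR' : ∀ π' : PermsG n, π' ∈ R' ↔ ∀ m₀, ∃ π ∈ R, ∀ m, U m = U m₀ → π m = π' m := fun π' => by simp [hR']
  have hRR' : R ⊆ R' := fun π hπ => (hmemR' π).2 fun m₀ => ⟨π, hπ, fun _ _ => rfl⟩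
  have hmul' : ∀ π ∈ R', ∀ π' ∈ R', π * π' ∈ R' := by
    intro π₁ h₁ π₂ h₂
    rw [hmemR'] at h₁ h₂ ⊢
    intro m₀
    obtain ⟨ρ₁, hρ₁, e₁⟩ := h₁ m₀
    obtain ⟨ρ₂, hρ₂, e₂⟩ := h₂ m₀
    exact ⟨ρ₁ * ρ₂, hmul _ hρ₁ _ hρ₂, fun m hm => by rw [Pi.mul_apply, Pi.mul_apply, e₁ m hm, e₂ m hm]⟩
  have hinv' : ∀ π ∈ R', π⁻¹ ∈ R' := by
    intro π₁ h₁
    rw [hmemR'] at h₁ ⊢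
    intro m₀
    obtain ⟨ρ, hρ, e⟩ := h₁ m₀
    exact ⟨ρ⁻¹, hinv _ hρ, fun m hm => by rw [Pi.inv_apply, Pi.inv_apply, e m hm]⟩
  have hne' : R'.Nonempty := hne.mono hRR'
  have htrans' : ∀ (m : Fin r) (a a' : Fin (n m)), ∃ π ∈ R', π m a = a' := fun m a a' => by
    obtain ⟨π, hπ, h⟩ := htrans m a a'
    exact ⟨π, hRR' hπ, h⟩
  -- hybrids: a tuple of `R` on the unit of `m`, another tuple of `R'` elsewhere, lies in `R'`
  have hhyb : ∀ (m : Fin r) (π : PermsG n), π ∈ R → ∀ π₀ ∈ R', (fun m' => if U m' = U m then π m' else π₀ m') ∈ R' := by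
    intro m π hπ π₀ hπ₀
    rw [hmemR'] at hπ₀ ⊢
    intro m₀
    by_cases hm₀ : U m₀ = U m
    · refine ⟨π, hπ, fun m' hm' => ?_⟩
      simp only [hm'.trans hm₀, if_true]
    · obtain ⟨ρ, hρ, e⟩ := hπ₀ m₀
      refine ⟨ρ, hρ, fun m' hm' => ?_⟩
      have : U m' ≠ U m := fun h => hm₀ (hm'.symm.trans h)
      simp only [this, if_false, e m' hm']
  -- the defects and the signed equations at `R`, transferred to `R'`
  set d : ∀ m : Fin r, Fin (n m) → ℤ := fun m a => ((cnt v T (Sum.inr ⟨m, (a, true)⟩)) : ℤ) - cnt v T (Sum.inr ⟨m, (a, false)⟩) with hd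
  have hsig : ∀ π ∈ R', (((cnt v T (Sum.inl true)) : ℤ) - cnt v T (Sum.inl false)) +
      ∑ m : Fin r, ∑ a : Fin (n m), (if π m a ∈ P m then d m a else -d m a) = 0 := fun π' hπ' =>
    signed_transfer_units (d := d) U hmul hne htrans (fun m₀ m hmm a a' => by
        have h₁ : m₀ ≠ m := fun h => hmm (by rw [h])
        have h₂ : tw m₀ ≠ m := fun h => hmm (by rw [← h, hUtw])
        obtain ⟨ν, hν, hν₀, hν₁, hνa⟩ := hstab m₀ m h₁ h₂ a a'
        refine ⟨ν, hν, fun m' hm' => ?_, hνa⟩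
        rcases (hUfib m₀ m').1 hm' with rfl | rfl
        exacts [hν₀, hν₁])
      (fun π hπ => signed_of_modelBalancedG R v hT hπ) π' ((hmemR' π').1 hπ')
  -- the twin slots
  let L : Finset (Fin r) := Finset.univ.filter fun m => tw m ≠ m
  have hmemL : ∀ m, m ∈ L ↔ tw m ≠ m := fun m => by simp [L]
  -- every SINGLE slot is moved ALONE, inside `R'`, by a tuple of prime order
  have hpure : ∀ m₀ : Fin r, m₀ ∉ L → ∃ ρ ∈ R', (∀ m ∈ L, ρ m = 1) ∧ (∀ m, m ∉ L → (m : ℕ) < (m₀ : ℕ) → ρ m = 1) ∧ orderOf (ρ m₀) = n m₀ := by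
    intro m₀ hm₀
    have htw₀ : tw m₀ = m₀ := by by_contra h; exact hm₀ ((hmemL m₀).2 h)
    have h2 : 2 ≤ n m₀ := (hpr m₀).two_le
    obtain ⟨π₁, hπ₁, hmove⟩ := htrans m₀ ⟨0, by omega⟩ ⟨1, by omega⟩
    have hσ : π₁ m₀ ≠ 1 := fun h => by
      have := hmove
      rw [h, Equiv.Perm.one_apply] at this
      exact absurd (congrArg Fin.val this) (by simp)
    have hex : ∃ π ∈ R', (∀ m ∈ Finset.univ.erase m₀, π m = 1) ∧ π m₀ ≠ 1 := by
      refine ⟨Function.update (1 : PermsG n) m₀ (π₁ m₀), (hmemR' _).2 fun m' => ?_, fun m hm' => ?_, ?_⟩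
      · by_cases hm' : U m' = U m₀
        · refine ⟨π₁, hπ₁, fun m hmm => ?_⟩
          have hmm' : m = m₀ := by
            rcases (hUfib m₀ m).1 (hmm.trans hm') with h | h
            · exact h
            · rw [h, htw₀]
          subst hmm'
          rw [Function.update_self]
        · refine ⟨1, h1R, fun m hmm => ?_⟩
          have hmm' : m ≠ m₀ := fun h => hm' (by rw [← h, hmm])
          rw [Function.update_of_ne hmm', Pi.one_apply]
      · rw [Function.update_of_ne (Finset.ne_of_mem_erase hm'), Pi.one_apply]
      · rw [Function.update_self]
        exact hσ
    obtain ⟨ρ, hρ, hρS, hord⟩ := exists_orderOf_eq_of_trivial_on hmul' hinv' hne' (hpr m₀) (htrans' m₀) (Finset.univ.erase m₀) hex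
    exact ⟨ρ, hρ, fun m hm => hρS m (Finset.mem_erase.2 ⟨fun h => hm₀ (h ▸ hm), Finset.mem_univ m⟩),
      fun m _ hlt => hρS m (Finset.mem_erase.2 ⟨fun h => by rw [h] at hlt; exact lt_irrefl _ hlt, Finset.mem_univ m⟩), hord⟩
  -- the prime tower with all twin slots excluded: the single-slot defects are constant
  have hconst := const_of_signed_primeTower (P := P) hmul' hne' L (fun m => (m : ℕ)) (fun m _ => hpr m)
    (fun m m' _ _ h => Fin.ext h) (fun m _ => hP0 m) (fun m _ => hPn m) hpure hsig
  -- the twin units, one at a time: vary the unit of `m` against a base tuple `π₀`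
  obtain ⟨π₀, hπ₀⟩ := hne'
  have htwins : ∀ m, tw m ≠ m → ∀ a b : Fin (n m), d m a = d m b := by
    intro m htm
    let D : Finset (PermsG n) := R'.filter fun π => ∀ m', U m' ≠ U m → π m' = π₀ m'
    have hD : ∀ π, π ∈ D ↔ π ∈ R' ∧ ∀ m', U m' ≠ U m → π m' = π₀ m' := fun π => Finset.mem_filter
    -- the signed equation on `D`: the other units are frozen
    set w : ℤ := -((((cnt v T (Sum.inl true)) : ℤ) - cnt v T (Sum.inl false)) +
      ∑ m' ∈ (Finset.univ.erase m).erase (tw m), ∑ a : Fin (n m'), (if π₀ m' a ∈ P m' then d m' a else -d m' a)) with hw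
    have hmt : tw m ∈ Finset.univ.erase m := Finset.mem_erase.2 ⟨htm, Finset.mem_univ _⟩
    have heqD : ∀ π ∈ D, (∑ a : Fin (n m), (if π m a ∈ P m then d m a else -d m a)) +
        (∑ a : Fin (n (tw m)), (if π (tw m) a ∈ P (tw m) then d (tw m) a else -d (tw m) a)) = w := by
      intro π hπ
      obtain ⟨hπR', hπfix⟩ := (hD π).1 hπ
      have hs := hsig π hπR'
      rw [← Finset.add_sum_erase _ _ (Finset.mem_univ m), ← Finset.add_sum_erase _ _ hmt] at hs
      have hrest : (∑ m' ∈ (Finset.univ.erase m).erase (tw m), ∑ a : Fin (n m'), (if π m' a ∈ P m' then d m' a else -d m' a)) =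
          ∑ m' ∈ (Finset.univ.erase m).erase (tw m), ∑ a : Fin (n m'), (if π₀ m' a ∈ P m' then d m' a else -d m' a) :=
        Finset.sum_congr rfl fun m' hm' => by
          have h₁ : m' ≠ tw m := Finset.ne_of_mem_erase hm'
          have h₂ : m' ≠ m := Finset.ne_of_mem_erase (Finset.mem_of_mem_erase hm')
          rw [hπfix m' (fun h => by rcases (hUfib m m').1 h with h' | h' <;> [exact h₂ h'; exact h₁ h'])]
      rw [hrest] at hs
      simp only [hw]
      linarith
    have htwin := const_of_signed_twin (P := P) (D := D) (m₁ := m) (m₂ := tw m) (hn m) (h3 m htm) (hPq m htm) (hPq (tw m) (by rw [htw]; exact Ne.symm htm))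
      (hq m htm)
      (fun π hπ a => by
        obtain ⟨hπR', -⟩ := (hD π).1 hπ
        obtain ⟨ρ, hρ, hρe⟩ := (hmemR' π).1 hπR' m
        rw [← hρe m rfl, ← hρe (tw m) (hUtw m)]
        exact hdiag ρ hρ m htm a)
      (fun a a' b b' haa hbb => by
        obtain ⟨π, hπ, hb, hb'⟩ := h2t m htm a a' b b' haa hbb
        refine ⟨fun m' => if U m' = U m then π m' else π₀ m', (hD _).2 ⟨hhyb m π hπ π₀ hπ₀, fun m' hm' => by simp only [hm', if_false]⟩, ?_, ?_⟩
        · show (if U m = U m then π m else π₀ m) a = b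
          rw [if_pos rfl]; exact hb
        · show (if U m = U m then π m else π₀ m) a' = b'
          rw [if_pos rfl]; exact hb')
      (d := d) (w := w) heqD
    exact htwin.1
  -- all defects are constant
  have hall : ∀ (m : Fin r) (a b : Fin (n m)), d m a = d m b := by
    intro m
    by_cases htm : tw m = m
    · exact hconst m (fun h => ((hmemL m).1 h) htm)
    · exact htwins m htm
  obtain ⟨t, hdt, he⟩ := exists_defects_of_const (P := P) ⟨π₀, hπ₀⟩ hall hsig
  refine ⟨t, fun m a => hdt m a, ?_⟩
  rw [he]
  exact Finset.sum_congr rfl fun m _ => by rw [hc m]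

end Model

end Summit.HodgeConjecture.CorCM.MultiFieldWeil

end
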